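import Summits.BirchSwinnertonDyer.BirchSwinnertonDyer.Theorems.KimAtThreeDeepLowerOffStratumLevelLoweringVatsalStabRows
import Summits.BirchSwinnertonDyer.Rank1Residual.X4.OldEigenSymbOfIhara
import Literature.NumberTheory.EllipticCurves.NewformsRealCoefficients
import HarnessLib

/-!
# Route `KimAtThreeKolyvagin` (rung W2), crux `DeepLowerAtThreeOffKatoStratum` (item 19679), registered
# stub `stub_nonAdditive`, ROAD (b): THEOREM D — the NON-DEGENERACY input of THEOREM A from IHARA'S LEMMA
# BY NAME (`ribet1984_iharaLemma`), for a newform `g` of level `M` and a prime `q ∤ M`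

Cell `bsd-addord`, seat `bsd-addord-w2-acc2` (PROGRAMME PART 1b, ACCEL-LIST row (2)), gen 4; item
`stmt-BirchSwinnertonDyer-19679` (OWNER w2-c2 assembles; `--supports`, closes nothing). Seventh file of ROAD (b).
THEOREM A (`…LevelLoweringVatsal`) and its row theorems (`…VatsalStabRows`, `…VatsalStabCovered`) display the
NON-DEGENERACY `Ω`: `plusSymbol g/Ω` integral on `ℚ` AND the `q`-stabilised symbol
`(plusSymbol g x₀ − c·plusSymbol g (q x₀))/Ω` a unit for some `x₀` — «Ihara's lemma read on plus symbols». THIS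
FILE proves the second clause from the tree's NAMED FACT `ribet1984_iharaLemma` (Ribet 1984 Thm. 4.1 /
Darmon–Diamond–Taylor Lemma 4.28 (a) + 4.30 (b), in period-homology currency) through cell b2b-bsdres'
`LevelLowering.exists_sub_mul_apply_ne_zero_of_ribet1984_iharaLemma`, GIVEN only: the integrality of
`plusSymbol g/Ω`, its NON-TRIVIALITY ON ONE CYCLE (`plusSymbol g (γ₀∞)/Ω` a unit for some `γ₀ ∈ Γ₀(M)` — the
normalisation is not degenerate on `H₁(X₀(M), ℤ)`), ONE non-Eisenstein numeral prime `r₀ ≡ 1 (mod Mq)`,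
`r₀ ∤ Mq`, with `a_{r₀}(g) ≢ r₀ + 1 (mod 𝔪)` (Darmon–Diamond–Taylor p. 120; in print from `ρ̄` irreducible by
Chebotarev), and `c ≡ 1`.

* §1 `exists_eigenvalue_heckeRing0` — a newform is an eigenvector of EVERY element of the full Hecke ring
  `𝕋_ℤ = ℤ[T_p] ⊆ End S₂(Γ₀(M))` (`HeckeRing0`, induction on `Algebra.adjoin`), with eigenvalue a real algebraic
  integer (`IsNewform0.isIntegral_coeff_holds`, `IsNewform0.cuspCoeff_im_eq_zero`); `toEnd_eq_cuspCoeff_smul`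
  (the eigenvalue is `a₁(t g)`), `cuspCoeff_toEnd_integral` (`3`-adically integral, spectral norm).
* §2 ★ `exists_valuation_stabilisedSymbol_eq_one_of_ribet1984_iharaLemma` — THEOREM D. Inside the proof (no
  top-level definition): the eigencharacter `λ : 𝕋_ℤ →+* ℂ`, its reduction `χ : 𝕋̃ = ℤ[T_r : r ∤ Mq] →+* 𝓀`
  (`𝓀 = 𝒪_{ℚ̄₃}/𝔪`) with `ker χ` MAXIMAL (`𝕋̃/ker χ` is a finitely generated `ℤ`-module killed by `3`, hence a
  finite domain, hence a field: `HeckeRing0.instModuleFinite`, `AddCommGroup.finite_of_fg_torsion`,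
  `Finite.isField_of_domain`) and NOT Eisenstein (`r₀`); the cycle functional `Λ(y) = (Re y(g)/Ω mod 𝔪)` on
  `S₂(Γ₀(M))^∨`, a `χ`-eigenvector on `H₁(X₀(M), ℤ) = {periodFunctional γ}` (`coe_periodHomology_eq_range`;
  `Re{∞, r}_g = plusSymbol g r`, real coefficients), non-zero at `{∞, γ₀∞}`, carrying
  `μ = (plusSymbol g/Ω mod 𝔪)`; Ihara gives `r` with `μ(r) − μ(qr) ≠ 0`, i.e. the stabilised symbol at `r` is a
  unit (`c ≡ 1`).

NET for ROAD (b): the residual (R3) «Ihara read on plus symbols» is REPLACED by {`ribet1984_iharaLemma` BY NAME,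
non-triviality of `Ω` on one cycle, one non-Eisenstein numeral}. What remains displayed on the depth-`1`
Tamagawa rows: (R1) Ribet's `g` in `Γ₀(N/q)` currency with its prime congruences, (R2) Vatsal's Condition 1 ×2,
the normalisation `Ω` (integral on `ℚ`, unit on one cycle — in print the canonical period of `g`), the numeral
`r₀`. Theorems only; nothing booked; BSD is not proved by any of this.

## References

* K. A. Ribet, *Congruence relations between modular forms*, Proc. ICM 1983 (1984), Thm. 4.1. [Ribet1984ICM]
* H. Darmon, F. Diamond, R. Taylor, *Fermat's Last Theorem* (1995), Lemma 4.28 (a), Lemma 4.30 (b), §4.5, p. 120.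
  [DarmonDiamondTaylor1995]
* J. E. Cremona, *Algorithms for modular elliptic curves* (1997), §2.1, §2.4. [CremonaAlgorithms1997]
* F. Diamond, J. Shurman (2005), Prop. 5.8.5 [DiamondShurman2005]; G. Shimura (1971), Thm. 3.48 [Shimura1971].
-/

set_option autoImplicit false
-- the Theorems namespace of a single-conjunct summit repeats the summit name by design (D-0017)
set_option linter.dupNamespace false

noncomputable section

open scoped MatrixGroups ModularForm Classical NNReal

open CongruenceSubgroup WeierstrassCurve Literature.NumberTheory.EllipticCurves
  Literature.NumberTheory.EllipticCurves.ModularForms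
open UpperHalfPlane hiding I

namespace Summit.BirchSwinnertonDyer.BirchSwinnertonDyer.Theorems.KimAtThreeDeepLowerOffStratumLevelLoweringVatsalIhara

open Summit.BirchSwinnertonDyer.BirchSwinnertonDyer.Theorems.KimAtThreeDeepLowerOffStratumLevelLoweringVatsal
open Summit.BirchSwinnertonDyer.BirchSwinnertonDyer.Theorems.KimAtThreeDeepLowerOffStratumLevelLoweringVatsalStabRows

/-! ### §1 The eigencharacter of a newform on the full Hecke ring `𝕋_ℤ` -/

section Eigen

variable {M : ℕ} [NeZero M] {g : CuspForm (Gamma0 M) 2} (hg : IsNewform0 g)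
include hg

/-- **A newform is an eigenvector of every element of `𝕋_ℤ = ℤ[T_p]`, with an eigenvalue that is a (real)
algebraic integer** (induction on `𝕋_ℤ = Algebra.adjoin ℤ {T_p}`; `T_p g = a_p(g) g`, `a_p(g)` real algebraic
integers: Diamond–Shurman Prop. 5.8.5, Shimura Thm. 3.48).
[cite: DiamondShurman2005, Prop. 5.8.5] [cite: Shimura1971, Thm. 3.48] -/
theorem exists_eigenvalue_heckeRing0 (t : HeckeRing0 M 2) :
    ∃ c : ℂ, HeckeRing0.toEnd M 2 t g = c • g ∧ IsIntegral ℤ c ∧ c.im = 0 := by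
  have ht : (HeckeRing0.toSubalgebra M 2 t : Module.End ℂ (CuspForm (Gamma0 M) 2)) ∈
      Algebra.adjoin ℤ (heckeRing0Generators M 2) := (HeckeRing0.toSubalgebra M 2 t).2
  rw [HeckeRing0.toEnd_apply]
  refine Algebra.adjoin_induction (p := fun e _ => ∃ c : ℂ, e g = c • g ∧ IsIntegral ℤ c ∧ c.im = 0)
    ?_ ?_ ?_ ?_ ht
  · rintro e ⟨p, hp, rfl⟩
    haveI : NeZero p := ⟨hp.ne_zero⟩
    exact ⟨cuspCoeff g p, hg.heckeT_eq_coeff_smul hp, IsNewform0.isIntegral_coeff_holds hg p,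
      hg.cuspCoeff_im_eq_zero p⟩
  · intro n
    refine ⟨(n : ℂ), ?_, isIntegral_algebraMap.map (Int.castRingHom ℂ).toIntAlgHom, by simp⟩
    rw [Algebra.algebraMap_eq_smul_one, LinearMap.smul_apply, Module.End.one_apply, Int.cast_smul_eq_zsmul]
  · rintro e₁ e₂ _ _ ⟨c₁, h₁, i₁, r₁⟩ ⟨c₂, h₂, i₂, r₂⟩
    refine ⟨c₁ + c₂, ?_, i₁.add i₂, by simp [r₁, r₂]⟩
    rw [LinearMap.add_apply, h₁, h₂, add_smul]
  · rintro e₁ e₂ _ _ ⟨c₁, h₁, i₁, r₁⟩ ⟨c₂, h₂, i₂, r₂⟩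
    refine ⟨c₁ * c₂, ?_, i₁.mul i₂, by simp [r₁, r₂]⟩
    rw [Module.End.mul_apply, h₂, map_smul, h₁, smul_smul, mul_comm]

/-- The eigenvalue is the first Fourier coefficient of `t g` (`a₁(g) = 1`). [cite: DiamondShurman2005, Prop. 5.8.5] -/
theorem toEnd_eq_cuspCoeff_smul (t : HeckeRing0 M 2) :
    HeckeRing0.toEnd M 2 t g = cuspCoeff (HeckeRing0.toEnd M 2 t g) 1 • g := by
  obtain ⟨c, hc, -, -⟩ := exists_eigenvalue_heckeRing0 hg t
  have : cuspCoeff (HeckeRing0.toEnd M 2 t g) 1 = c := by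
    rw [hc, cuspCoeff, qExpansion_coeff_smul, show (qExpansion 1 ⇑g).coeff 1 = 1 from hg.2.2, mul_one]
  rw [this, hc]

/-- The eigenvalue `a₁(t g)` is a real algebraic integer, hence `3`-adically integral. [cite: Shimura1971, Thm. 3.48] -/
theorem cuspCoeff_toEnd_integral (ι : PadicAlgCl 3 ≃+* ℂ) (t : HeckeRing0 M 2) :
    IsIntegral ℤ (cuspCoeff (HeckeRing0.toEnd M 2 t g) 1) ∧ (cuspCoeff (HeckeRing0.toEnd M 2 t g) 1).im = 0 ∧
      ‖ι.symm (cuspCoeff (HeckeRing0.toEnd M 2 t g) 1)‖ ≤ 1 := by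
  obtain ⟨c, hc, hi, hr⟩ := exists_eigenvalue_heckeRing0 hg t
  have : cuspCoeff (HeckeRing0.toEnd M 2 t g) 1 = c := by
    rw [hc, cuspCoeff, qExpansion_coeff_smul, show (qExpansion 1 ⇑g).coeff 1 = 1 from hg.2.2, mul_one]
  rw [this]
  exact ⟨hi, hr, norm_le_one_of_isIntegral_int (hi.map (ι.symm : ℂ →+* PadicAlgCl 3).toIntAlgHom)⟩

end Eigen

/-! ### §2 THEOREM D: Ihara's lemma BY NAME ⟹ the non-degeneracy `Ω` of ROAD (b) -/

section Ihara

open Summit.BirchSwinnertonDyer.Rank1Residual.LevelLowering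

/-- **THEOREM D — the NON-DEGENERACY input of ROAD (b) from `ribet1984_iharaLemma` BY NAME.** Let `g` be a
newform of level `Γ₀(M)`, `q ∤ M` a prime, `Ω ∈ ℂ` with `plusSymbol g x/Ω` `3`-integral for all `x ∈ ℚ`
and a UNIT at some cusp `γ₀∞`, `γ₀ ∈ Γ₀(M)` (non-triviality of the normalisation on one cycle), a prime
`r₀ ≡ 1 (mod Mq)`, `r₀ ∤ Mq`, with `a_{r₀}(g) ≢ r₀ + 1 (mod 𝔪)` (one non-Eisenstein numeral), and `c ≡ 1`.
Then the `q`-stabilised symbol `(plusSymbol g x₀ − c·plusSymbol g (q x₀))/Ω` is a unit for some `x₀ ∈ ℚ`.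
Proof: the reduced eigencharacter `χ : 𝕋̃ → 𝓀` of `g` (kernel maximal: `𝕋̃/ker χ` is a finite domain; not
Eisenstein by `r₀`) and the cycle functional `Λ(y) = (Re y(g)/Ω mod 𝔪)` (a `χ`-eigenvector on `H₁(X₀(M), ℤ)`,
non-zero at `{∞, γ₀∞}`, carrying `μ = plusSymbol g/Ω mod 𝔪`) feed cell b2b-bsdres'
`exists_sub_mul_apply_ne_zero_of_ribet1984_iharaLemma`. [cite: Ribet1984ICM, Thm. 4.1]
[cite: DarmonDiamondTaylor1995, Lemma 4.28 (a), Lemma 4.30 (b), §4.5 pp. 135–137] [cite: CremonaAlgorithms1997, §2.4] -/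
theorem exists_valuation_stabilisedSymbol_eq_one_of_ribet1984_iharaLemma (hI : ribet1984_iharaLemma)
    {M q : ℕ} [NeZero M] (hq : q.Prime) (hqM : ¬ q ∣ M) {g : CuspForm (Gamma0 M) 2} (hg : IsNewform0 g)
    (ι : PadicAlgCl 3 ≃+* ℂ) {Ω : ℂ} (hΩint : ∀ x : ℚ, Valued.v (ι.symm (plusSymbol g x / Ω)) ≤ 1)
    (γ₀ : Gamma0 M) (hγ₀ : (γ₀ : SL(2, ℤ)) 1 0 ≠ 0)
    (hunit : Valued.v (ι.symm (plusSymbol g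
      ((((γ₀ : SL(2, ℤ)) 0 0 : ℤ) : ℚ) / (((γ₀ : SL(2, ℤ)) 1 0 : ℤ) : ℚ)) / Ω)) = 1)
    {r₀ : ℕ} (hr₀ : r₀.Prime) (hr₀S : ¬ r₀ ∣ M * q) (hr₀1 : r₀ ≡ 1 [MOD M * q])
    (hE₀ : Valued.v (ι.symm (cuspCoeff g r₀ - (r₀ + 1))) = 1)
    {c : ℂ} (hc : Valued.v (ι.symm (c - 1)) < 1) :
    ∃ x₀ : ℚ, Valued.v (ι.symm ((plusSymbol g x₀ - c * plusSymbol g (q * x₀)) / Ω)) = 1 := by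
  classical
  haveI : Fact q.Prime := ⟨hq⟩
  haveI := charP_residueField
  set res := IsLocalRing.residue (Valued.integer (PadicAlgCl 3)) with hres
  have hreal : ∀ n, (cuspCoeff g n).im = 0 := hg.cuspCoeff_im_eq_zero
  -- (a) the eigencharacter `λ : 𝕋_ℤ → ℂ`
  set lam : HeckeRing0 M 2 → ℂ := fun t => cuspCoeff (HeckeRing0.toEnd M 2 t g) 1 with hlam
  have hlam_smul : ∀ t, HeckeRing0.toEnd M 2 t g = lam t • g := fun t => toEnd_eq_cuspCoeff_smul hg t
  have hlam_one_coeff : ∀ (a : ℂ), cuspCoeff (a • g) 1 = a := fun a => by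
    rw [cuspCoeff, qExpansion_coeff_smul, show (qExpansion 1 ⇑g).coeff 1 = 1 from hg.2.2, mul_one]
  let lamHom : HeckeRing0 M 2 →+* ℂ :=
    { toFun := lam
      map_one' := by
        show cuspCoeff (HeckeRing0.toEnd M 2 1 g) 1 = 1
        rw [map_one, Module.End.one_apply]
        exact hg.2.2
      map_mul' := fun s t => by
        show cuspCoeff (HeckeRing0.toEnd M 2 (s * t) g) 1 = lam s * lam t
        rw [map_mul, Module.End.mul_apply, hlam_smul t, map_smul, hlam_smul s, smul_smul, hlam_one_coeff, mul_comm]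
      map_zero' := by
        show cuspCoeff (HeckeRing0.toEnd M 2 0 g) 1 = 0
        rw [map_zero, LinearMap.zero_apply, ← zero_smul ℂ g, hlam_one_coeff]
      map_add' := fun s t => by
        show cuspCoeff (HeckeRing0.toEnd M 2 (s + t) g) 1 = lam s + lam t
        rw [map_add, LinearMap.add_apply, hlam_smul s, hlam_smul t, ← add_smul, hlam_one_coeff] }
  have hlamHom : ∀ t, lamHom t = lam t := fun _ => rfl
  have hlam_int : ∀ t, ‖ι.symm (lam t)‖ ≤ 1 := fun t => (cuspCoeff_toEnd_integral hg ι t).2.2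
  have hlam_real : ∀ t, (lam t).im = 0 := fun t => (cuspCoeff_toEnd_integral hg ι t).2.1
  -- (b) `χ₀ : 𝕋_ℤ → 𝒪`, `χ : 𝕋̃ → 𝓀`
  let χ₀ : HeckeRing0 M 2 →+* (Valued.integer (PadicAlgCl 3)) :=
    ((ι.symm : ℂ →+* PadicAlgCl 3).comp lamHom).codRestrict (Valued.integer (PadicAlgCl 3)) fun t =>
      mem_integer_iff_norm_le_one.mpr (hlam_int t)
  have hχ₀ : ∀ t, (χ₀ t : PadicAlgCl 3) = ι.symm (lam t) := fun _ => rfl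
  let χ : HeckeRing0.primeTo M 2 (M * q) →+* IsLocalRing.ResidueField (Valued.integer (PadicAlgCl 3)) :=
    (res.comp χ₀).comp (HeckeRing0.primeTo M 2 (M * q)).val.toRingHom
  have hχ : ∀ s : HeckeRing0.primeTo M 2 (M * q), χ s = res (χ₀ (s : HeckeRing0 M 2)) := fun _ => rfl
  -- (c) `ker χ` is maximal: `𝕋̃ / ker χ` is a finite domain
  have h3ker : (3 : HeckeRing0.primeTo M 2 (M * q)) ∈ RingHom.ker χ := by
    rw [RingHom.mem_ker, map_ofNat]
    exact CharP.cast_eq_zero _ 3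
  haveI hfinT : Module.Finite ℤ (HeckeRing0.primeTo M 2 (M * q)) :=
    Module.Finite.of_injective (HeckeRing0.primeTo M 2 (M * q)).val.toLinearMap Subtype.val_injective
  have h𝔫 : (RingHom.ker χ).IsMaximal := by
    set Q := HeckeRing0.primeTo M 2 (M * q) ⧸ RingHom.ker χ with hQ
    haveI : IsDomain Q := (RingHom.quotientKerEquivRange χ).toMulEquiv.isDomain
    haveI : Module.Finite ℤ Q := Module.Finite.of_surjective
      (Ideal.Quotient.mkₐ ℤ (RingHom.ker χ)).toLinearMap (Ideal.Quotient.mkₐ_surjective ℤ _)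
    haveI : AddGroup.FG Q := Module.Finite.iff_addGroup_fg.mp inferInstance
    have h3Q : (3 : Q) = 0 := by
      have h := Ideal.Quotient.eq_zero_iff_mem.mpr h3ker
      rwa [map_ofNat] at h
    have htors : AddMonoid.IsTorsion Q := by
      intro x
      rw [isOfFinAddOrder_iff_nsmul_eq_zero]
      refine ⟨3, by norm_num, ?_⟩
      rw [nsmul_eq_mul, Nat.cast_ofNat, h3Q, zero_mul]
    haveI : Finite Q := AddCommGroup.finite_of_fg_torsion Q htors
    exact Ideal.Quotient.maximal_of_isField _ (Finite.isField_of_domain Q)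
  have h2 : (2 : IsLocalRing.ResidueField (Valued.integer (PadicAlgCl 3))) ≠ 0 := by
    intro h
    have h3 : (3 : IsLocalRing.ResidueField (Valued.integer (PadicAlgCl 3))) = 0 := by exact_mod_cast CharP.cast_eq_zero _ 3
    have : (1 : IsLocalRing.ResidueField (Valued.integer (PadicAlgCl 3))) = 0 := by
      have e : (3 : IsLocalRing.ResidueField (Valued.integer (PadicAlgCl 3))) - 2 = 1 := by norm_num
      rw [← e, h, h3, sub_zero]
    exact one_ne_zero this
  -- (d) `ker χ` is not Eisenstein: the numeral `r₀`
  have hE : ¬ HeckeRing0.primeTo.IsEisenstein (RingHom.ker χ) := by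
    intro hEis
    have hmem := hEis r₀ hr₀ hr₀S hr₀1
    rw [RingHom.mem_ker, map_sub, hχ] at hmem
    have hT : lam ((HeckeRing0.primeTo.T M 2 (M * q) hr₀ hr₀S : HeckeRing0.primeTo M 2 (M * q)) :
        HeckeRing0 M 2) = cuspCoeff g r₀ := by
      haveI : NeZero r₀ := ⟨hr₀.ne_zero⟩
      show cuspCoeff (HeckeRing0.toEnd M 2 (HeckeRing0.T M 2 r₀ hr₀) g) 1 = cuspCoeff g r₀
      rw [HeckeRing0.toEnd_T, hg.heckeT_eq_coeff_smul hr₀, hlam_one_coeff]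
      rfl
    have hval : res (χ₀ ((HeckeRing0.primeTo.T M 2 (M * q) hr₀ hr₀S : HeckeRing0.primeTo M 2 (M * q)) :
        HeckeRing0 M 2)) - ((r₀ : IsLocalRing.ResidueField (Valued.integer (PadicAlgCl 3))) + 1) = 0 := by
      have : χ ((r₀ : HeckeRing0.primeTo M 2 (M * q)) + 1) =
          (r₀ : IsLocalRing.ResidueField (Valued.integer (PadicAlgCl 3))) + 1 := by
        rw [map_add, map_natCast, map_one]
      rwa [this] at hmem
    -- but `a_{r₀}(g) − (r₀ + 1)` is a unit
    have hmemO : ι.symm (cuspCoeff g r₀ - (r₀ + 1)) ∈ (Valued.integer (PadicAlgCl 3)) :=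
      mem_integer_iff_norm_le_one.mpr (valuation_eq_one_iff.mp hE₀).le
    have hunit' : res ⟨ι.symm (cuspCoeff g r₀ - (r₀ + 1)), hmemO⟩ ≠ 0 := by
      rw [Ne, IsLocalRing.residue_eq_zero_iff, IsLocalRing.mem_maximalIdeal, mem_nonunits_iff, not_not,
        Valuation.Integers.isUnit_iff_valuation_eq_one (Valuation.integer.integers _)]
      exact hE₀
    apply hunit'
    have heq : (⟨ι.symm (cuspCoeff g r₀ - (r₀ + 1)), hmemO⟩ : (Valued.integer (PadicAlgCl 3))) =
        χ₀ ((HeckeRing0.primeTo.T M 2 (M * q) hr₀ hr₀S : HeckeRing0.primeTo M 2 (M * q)) : HeckeRing0 M 2) -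
          ((r₀ : (Valued.integer (PadicAlgCl 3))) + 1) := by
      apply Subtype.ext
      push_cast
      rw [hχ₀, hT, map_sub, map_add, map_natCast, map_one]
    rw [heq, map_sub, map_add, map_natCast, map_one]
    exact hval
  -- (e) the cycle functional `Λ`
  let R : ℂ → IsLocalRing.ResidueField (Valued.integer (PadicAlgCl 3)) := fun z =>
    if h : ‖ι.symm z‖ ≤ 1 then res ⟨ι.symm z, mem_integer_iff_norm_le_one.mpr h⟩ else 0
  have hR : ∀ {z : ℂ} (h : ‖ι.symm z‖ ≤ 1), R z = res ⟨ι.symm z, mem_integer_iff_norm_le_one.mpr h⟩ :=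
    fun h => dif_pos h
  let Λ : Module.Dual ℂ (CuspForm (Gamma0 M) 2) → IsLocalRing.ResidueField (Valued.integer (PadicAlgCl 3)) :=
    fun y => R ((((y g).re : ℝ) : ℂ) / Ω)
  let μ : ℚ → IsLocalRing.ResidueField (Valued.integer (PadicAlgCl 3)) := fun r => R (plusSymbol g r / Ω)
  -- real parts of cycle values are plus symbols (or `0`), hence integral after division by `Ω`
  have hplus : ∀ r : ℚ, (((modularSymbol g r).re : ℝ) : ℂ) = plusSymbol g r :=
    fun r => (plusSymbol_eq_re_holds g hreal r).symm
  have hcycle : ∀ x ∈ periodHomology M, ‖ι.symm ((((x g).re : ℝ) : ℂ) / Ω)‖ ≤ 1 := by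
    intro x hx
    have hx' : x ∈ (periodHomology M : Set (Module.Dual ℂ (CuspForm (Gamma0 M) 2))) := hx
    rw [coe_periodHomology_eq_range] at hx'
    obtain ⟨γ, rfl⟩ := hx'
    rw [periodFunctional_apply, cuspSymbol]
    split_ifs with hc0
    · rw [Complex.zero_re, Complex.ofReal_zero, zero_div, map_zero, norm_zero]
      exact zero_le_one
    · rw [hplus]
      exact valuation_le_one_iff.mp (hΩint _)
  have hΛ : ∀ (s : HeckeRing0.primeTo M 2 (M * q)), ∀ x ∈ periodHomology M,
      Λ ((s : HeckeRing0 M 2) • x) = χ s * Λ x := by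
    intro s x hx
    have hsx : ((s : HeckeRing0 M 2) • x) g = lam s * x g := by
      rw [HeckeRing0.smul_dual_apply, hlam_smul, map_smul, smul_eq_mul]
    have hre : (((((s : HeckeRing0 M 2) • x) g).re : ℝ) : ℂ) / Ω = lam s * (((((x g).re : ℝ) : ℂ)) / Ω) := by
      rw [hsx, Complex.mul_re, hlam_real, zero_mul, sub_zero, Complex.ofReal_mul, mul_div_assoc]
      congr 1
      exact Complex.ext (by simp) (by simp [hlam_real])
    have h1 : ‖ι.symm (lam s)‖ ≤ 1 := hlam_int s
    have h2' := hcycle x hx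
    have h12 : ‖ι.symm (lam s * ((((x g).re : ℝ) : ℂ) / Ω))‖ ≤ 1 := by
      rw [map_mul, norm_mul]; exact mul_le_one₀ h1 (norm_nonneg _) h2'
    show R _ = χ s * R _
    rw [hre, hR h12, hR h2', hχ, ← map_mul]
    congr 1
    apply Subtype.ext
    push_cast
    rw [map_mul, hχ₀]
  have hμΛ : ∀ y ∈ periodHomology M, ∀ r : ℚ,
      (∀ f : CuspForm (Gamma0 M) 2, y f = modularSymbol f r) → μ r = Λ y := by
    intro y _ r hy
    show R _ = R _
    rw [hy g, hplus]
  have hx₀ : periodFunctional M γ₀ ∈ periodHomology M := periodFunctional_mem_periodHomology M γ₀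
  have hΛx : Λ (periodFunctional M γ₀) ≠ 0 := by
    show R _ ≠ 0
    rw [periodFunctional_apply, cuspSymbol, if_neg hγ₀, hplus, hR (valuation_eq_one_iff.mp hunit).le]
    rw [Ne, IsLocalRing.residue_eq_zero_iff, IsLocalRing.mem_maximalIdeal, mem_nonunits_iff, not_not,
      Valuation.Integers.isUnit_iff_valuation_eq_one (Valuation.integer.integers _)]
    exact hunit
  -- (f) Ihara
  obtain ⟨r, hr⟩ := exists_sub_mul_apply_ne_zero_of_ribet1984_iharaLemma hI hqM Λ χ hΛ h𝔫 h2 hE hx₀ hΛx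
    (1 : IsLocalRing.ResidueField (Valued.integer (PadicAlgCl 3))) hμΛ
  refine ⟨r, ?_⟩
  have hA := valuation_le_one_iff.mp (hΩint r)
  have hB := valuation_le_one_iff.mp (hΩint (q * r))
  have hC : ‖ι.symm c‖ ≤ 1 := by
    have : ι.symm c = ι.symm (c - 1) + 1 := by rw [map_sub, map_one, sub_add_cancel]
    rw [this]
    exact (PadicAlgCl.isNonarchimedean 3 _ _).trans (max_le (valuation_lt_one_iff.mp hc).le (by rw [norm_one]))
  have hc1 : res ⟨ι.symm c, mem_integer_iff_norm_le_one.mpr hC⟩ = 1 := by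
    have h := residue_mk_eq_of_norm_sub_lt_one (mem_integer_iff_norm_le_one.mpr hC)
      (one_mem (Valued.integer (PadicAlgCl 3))) (by
      rw [← map_one ι.symm, ← map_sub]; exact valuation_lt_one_iff.mp hc)
    rw [h]; exact map_one res
  have hABC : ‖ι.symm ((plusSymbol g r - c * plusSymbol g (q * r)) / Ω)‖ ≤ 1 := by
    rw [sub_div, mul_div_assoc, map_sub, map_mul, sub_eq_add_neg]
    refine (PadicAlgCl.isNonarchimedean 3 _ _).trans (max_le hA ?_)
    rw [norm_neg, norm_mul]; exact mul_le_one₀ hC (norm_nonneg _) hB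
  have hresid : res ⟨ι.symm ((plusSymbol g r - c * plusSymbol g (q * r)) / Ω), mem_integer_iff_norm_le_one.mpr hABC⟩ =
      μ r - 1 * μ (q * r) := by
    show _ = R _ - 1 * R _
    rw [hR hA, hR hB, ← hc1, ← map_mul, ← map_sub]
    congr 1
    apply Subtype.ext
    push_cast
    rw [sub_div, mul_div_assoc, map_sub, map_mul]
  refine valuation_eq_one_iff.mpr (le_antisymm hABC ?_)
  by_contra hlt
  push Not at hlt
  apply hr
  rw [← hresid]
  exact residue_mk_eq_zero_of_norm_lt_one _ hlt

end Ihara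

end Summit.BirchSwinnertonDyer.BirchSwinnertonDyer.Theorems.KimAtThreeDeepLowerOffStratumLevelLoweringVatsalIhara

end
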